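import Summits.CriticalPhenomena.Ising3D.Control2DPolyCertAuto
import Summits.CriticalPhenomena.Ising3D.Control2DUZSplit
import HarnessLib

/-!
# Flat assembly of a cell polynomial from INDEPENDENT index-group sums
(cell `pub-ising3x`, seat controls-1 gen 18; KERNEL PATH for the 2D γ-certificates — CONTROL-ONLY scaffolding)

HONEST FRAMING: lottery ticket; floor = tightest certified 3D Ising CFT bounds; no exact-solution
claim without a proof. Nothing about any CFT is asserted here.

The g15/g17 split layout assembles a spin's cell polynomial `cellPolyZ wt Sl Λ ℓ Nd` from partial sums that are
ACCUMULATED along the index list (`cellPolyAcc … acc`, `cellPolyAcc_append`): partial sum `g` is stated on top of the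
literal of partial sum `g+1`, so the data files of one spin form a CHAIN, and the gate — which bounces a proposal whose
import has not landed yet — lands them one cycle at a time (Λ = 15, `Nd = 63`: 6–9 cycles per spin). This file proves the
two list identities that make the group sums INDEPENDENT (`acc = []` each, any number of files proposable at once) and
re-assemble them by coefficientwise addition of literals only:
* `cellPolyAcc_acc : cellPolyAcc wt G Λ ℓ Nd acc = zadd (cellPolyAcc wt G Λ ℓ Nd []) acc` (`zadd` associativity);
* `cellPolyZ_of_groups : cellPolyZ wt Gs.flatten Λ ℓ Nd = (Gs.map fun G => cellPolyAcc wt G Λ ℓ Nd []).foldr zadd []`.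
A replay then reads: `rw [show slLΛ = [G₁, …, Gₙ].flatten from rfl, cellPolyZ_of_groups]`, `simp only [List.map_cons,
List.map_nil, List.foldr_cons, List.foldr_nil, grp₁_eq, …, grpₙ_eq]`, `decide +kernel` (a `zadd` of `n` literals).
Exact mirror: HOME/code/controls/kp5 (controls-1 g18). No facts, standard axioms only.
-/

namespace Summit.CriticalPhenomena.Ising3D.Control2D

/-- **Accumulator independence**: accumulating a group onto `acc` is adding the group's own sum to `acc`. [folklore] -/
theorem cellPolyAcc_acc (wt : ℕ × ℕ → ℤ) (Λ ℓ Nd : ℕ) :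
    ∀ (G : List (ℕ × ℕ)) (acc : List ℤ), cellPolyAcc wt G Λ ℓ Nd acc = zadd (cellPolyAcc wt G Λ ℓ Nd []) acc
  | [], _ => rfl
  | p :: G, acc => by
      show zadd (cellTermZ wt Λ ℓ Nd p) (cellPolyAcc wt G Λ ℓ Nd acc) =
        zadd (zadd (cellTermZ wt Λ ℓ Nd p) (cellPolyAcc wt G Λ ℓ Nd [])) acc
      rw [cellPolyAcc_acc wt Λ ℓ Nd G acc, zadd_assoc]

/-- **The cell polynomial from independent group sums**: for an index list given as a concatenation of groups,
`cellPolyZ` is the coefficientwise sum (`zadd`, right-nested) of the groups' own sums. [folklore] -/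
theorem cellPolyZ_of_groups (wt : ℕ × ℕ → ℤ) (Λ ℓ Nd : ℕ) :
    ∀ Gs : List (List (ℕ × ℕ)),
      cellPolyZ wt Gs.flatten Λ ℓ Nd = (Gs.map fun G => cellPolyAcc wt G Λ ℓ Nd []).foldr zadd []
  | [] => rfl
  | G :: Gs => by
      have ih := cellPolyZ_of_groups wt Λ ℓ Nd Gs
      rw [cellPolyZ_eq_acc] at ih
      rw [List.flatten_cons, cellPolyZ_eq_acc, cellPolyAcc_append, cellPolyAcc_acc, ih, List.map_cons,
        List.foldr_cons]

end Summit.CriticalPhenomena.Ising3D.Control2D
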